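import Summits.CriticalPhenomena.SAWScalingLimit.Theorems.SAWDevelopingMapObservableToSLECanonicalTransferReduction
import Summits.CriticalPhenomena.SAWScalingLimit.Theorems.SAWDevelopingMapObservableToSLECanonicalTransferCanonicalInsensitivity
import HarnessLib

/-!
# Crux `SAWDevelopingMap.ObservableToSLE` (stmt-CriticalPhenomena-10472), line
`floor-ratio-restriction-bootstrap`, stub `stub_canonicalTransfer`: THE STUB FROM (HA) ALONE

Landing target:
`Summits/CriticalPhenomena/SAWScalingLimit/Theorems/SAWDevelopingMapObservableToSLECanonicalTransferReductionHA.lean`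
(`--supports stmt-CriticalPhenomena-10472`).  Sequel of `…CanonicalTransferReduction.lean` and
`…CanonicalTransferCanonicalInsensitivity.lean`.

* `admissible_rows` (= registered sub-goal `stub_canonicalTransfer_admissibleRows`) — the exact-row
  clause of the admissibility in implication form;
* `discretisation_of_hullApprox` — the discretisation input (M1) + (M2'a) + (M2'b) of
  `canonicalTransfer_ofDiscretisation` from the admissible restriction limit and (HA) ALONE;
* `canonicalTransfer_of_hullApprox` — **the registered statement of `stub_canonicalTransfer`,
  verbatim, from the single continuum hypothesis (HA)**: hull approximation from outside — every
  hull subdomain `D'` of a Dobrushin domain `D` is approximated by hull subdomains `D'' ⊇ D'`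
  swallowing a metric collar `{z ∈ D | dist(z, D') ≤ η}` with restriction derivative numbers
  `Φ'_{A''}(0)^{5/8} ≤ (1 + ε) Φ'_A(0)^{5/8}` (Carathéodory kernel continuity of `A ↦ Φ'_A(0)`
  for shrinking smooth hulls, cf. `HasRestrictionDeriv.tendsto_of_kernel_holds`, plus the
  Carathéodory homeomorphic boundary extension for the metric margin).
-/

noncomputable section

open scoped Topology BigOperators NNReal ENNReal
open Filter Set Metric MeasureTheory
open Literature.Probability.LatticeModels (HexVertex hexGraph hexCenter Site)
open Literature.Probability.RandomPlanarGeometry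
open Literature.Probability.RandomPlanarGeometry.SAW
open Literature.Probability.Percolation (PathIn)
open UpperHalfPlane (upperHalfPlaneSet)

namespace Summit.CriticalPhenomena.SAWScalingLimit.Theorems.ObservableToSLE.FloorRatio

/-- **Registered sub-goal `stub_canonicalTransfer_admissibleRows`** (crux item stmt-CriticalPhenomena-10472,
stub `stub_canonicalTransfer`): the exact-row clause of the admissibility of a nested pair, in the
implication form consumed by the insensitivity theorems. [folklore] -/
theorem stub_canonicalTransfer_admissibleRows :
    ∀ (D : DobrushinDomain) (E : Set ℂ) (ρ' : ℝ) (Λ Λ' : ℝ → Finset HexVertex) (m : ℝ → ℤ)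
    (σa σb : ℝ → Sym2 HexVertex),
    (∀ᶠ δ : ℝ in 𝓝[>] 0,
    Λ' δ ⊆ Λ δ ∧ hexDomainSimplyConnected (Λ δ) ∧ hexDomainSimplyConnected (Λ' δ) ∧
    (hexGraph.induce (↑(Λ δ) : Set HexVertex)).Preconnected ∧
    (hexGraph.induce (↑(Λ' δ) : Set HexVertex)).Preconnected ∧
    σa δ ∈ hexDomainBoundary (Λ δ) ∧ σb δ ∈ hexDomainBoundary (Λ δ) ∧
    σa δ ∈ hexDomainBoundary (Λ' δ) ∧ σb δ ∈ hexDomainBoundary (Λ' δ) ∧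
    Nonempty (HexMidEdgeSAW (Λ' δ) (σa δ) (σb δ)) ∧
    (∀ v ∈ Λ δ, (δ : ℂ) * hexCenter v ∈ D.carrier ∧ m δ ≤ v.1 1) ∧
    (∀ v ∈ Λ' δ, (δ : ℂ) * hexCenter v ∈ E) ∧
    (∀ v : HexVertex, (δ : ℂ) * hexCenter v ∈ ball (D.pt 0) ρ' ∪ ball (D.pt 1) ρ' →
    ((v ∈ Λ δ ↔ m δ ≤ v.1 1) ∧ (v ∈ Λ' δ ↔ m δ ≤ v.1 1)))) →
    ∀ᶠ δ : ℝ in 𝓝[>] 0, ∀ v : HexVertex,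
      (δ : ℂ) * hexCenter v ∈ ball (D.pt 0) ρ' ∪ ball (D.pt 1) ρ' → m δ ≤ v.1 1 →
        v ∈ Λ δ ∧ v ∈ Λ' δ := by
  intro D E ρ' Λ Λ' m σa σb hADM
  filter_upwards [hADM] with δ h v hv hvm
  obtain ⟨-, -, -, -, -, -, -, -, -, -, -, -, hrow⟩ := h
  exact ⟨((hrow v hv).1).2 hvm, ((hrow v hv).2).2 hvm⟩

/-- **THE DISCRETISATION INPUT FROM (HA) ALONE.**  Under the admissible restriction limit, the whole
discretisation input (M1) + (M2'a) + (M2'b) of `canonicalTransfer_ofDiscretisation` follows from the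
single continuum hypothesis (HA) hull approximation from outside: (M1) is `discretisation_core`,
(M2'a) = (CI) is `canonicalInsensitivity_of_hullApprox` (half-disc super-domain), (M2'b) is
`insensitivity_of_hullApprox`. [cite: LawlerSchrammWerner2004SAW, §3.4 ("SAW satisfies restriction")] -/
theorem discretisation_of_hullApprox :
    (∀ (D D' : DobrushinDomain) (ρ : ℝ) (φ : ConformalEquiv upperHalfPlaneSet D.carrier)
    (Φ : ConformalEquiv (upperHalfPlaneSet \ φ.pullbackHull D') upperHalfPlaneSet) (d : ℝ)
    (Λ Λ' : ℝ → Finset HexVertex) (m : ℝ → ℤ) (a b : ℝ → Sym2 HexVertex),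
    (0 < ρ ∧ (D.pt 1).im = (D.pt 0).im ∧ D.carrier ⊆ {z : ℂ | (D.pt 0).im < z.im} ∧
    D.carrier ∩ ball (D.pt 0) ρ = {z : ℂ | (D.pt 0).im < z.im} ∩ ball (D.pt 0) ρ ∧
    D.carrier ∩ ball (D.pt 1) ρ = {z : ℂ | (D.pt 1).im < z.im} ∩ ball (D.pt 1) ρ) → D.IsHullSubdomain D' → D.IsChordalUniformizing φ →
    IsRestrictionMap (φ.pullbackHull D') Φ → HasRestrictionDeriv (φ.pullbackHull D') Φ d →
    (∀ᶠ δ : ℝ in 𝓝[>] 0,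
    Λ' δ ⊆ Λ δ ∧ hexDomainSimplyConnected (Λ δ) ∧ hexDomainSimplyConnected (Λ' δ) ∧
    (hexGraph.induce (↑(Λ δ) : Set HexVertex)).Preconnected ∧
    (hexGraph.induce (↑(Λ' δ) : Set HexVertex)).Preconnected ∧
    a δ ∈ hexDomainBoundary (Λ δ) ∧ b δ ∈ hexDomainBoundary (Λ δ) ∧
    a δ ∈ hexDomainBoundary (Λ' δ) ∧ b δ ∈ hexDomainBoundary (Λ' δ) ∧
    Nonempty (HexMidEdgeSAW (Λ' δ) (a δ) (b δ)) ∧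
    (∀ v ∈ Λ δ, (δ : ℂ) * hexCenter v ∈ D.carrier ∧ m δ ≤ v.1 1) ∧
    (∀ v ∈ Λ' δ, (δ : ℂ) * hexCenter v ∈ D'.carrier) ∧
    (∀ v : HexVertex, (δ : ℂ) * hexCenter v ∈ ball (D.pt 0) ρ ∪ ball (D.pt 1) ρ →
    ((v ∈ Λ δ ↔ m δ ≤ v.1 1) ∧ (v ∈ Λ' δ ↔ m δ ≤ v.1 1)))) →
    (∀ K : Set ℂ, IsCompact K → K ⊆ D.carrier →
    ∀ᶠ δ : ℝ in 𝓝[>] 0, ∀ v : HexVertex, (δ : ℂ) * hexCenter v ∈ K → v ∈ Λ δ) →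
    (∀ K : Set ℂ, IsCompact K → K ⊆ D'.carrier →
    ∀ᶠ δ : ℝ in 𝓝[>] 0, ∀ v : HexVertex, (δ : ℂ) * hexCenter v ∈ K → v ∈ Λ' δ) →
    Tendsto (fun δ : ℝ => (δ : ℂ) * hexMidpoint (a δ)) (𝓝[>] 0) (𝓝 (D.pt 0)) →
    Tendsto (fun δ : ℝ => (δ : ℂ) * hexMidpoint (b δ)) (𝓝[>] 0) (𝓝 (D.pt 1)) →
    Tendsto (fun δ : ℝ => (∑ γ : HexMidEdgeSAW (Λ' δ) (a δ) (b δ), hexCriticalFugacity ^ γ.length) /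
    (∑ γ : HexMidEdgeSAW (Λ δ) (a δ) (b δ), hexCriticalFugacity ^ γ.length)) (𝓝[>] 0)
    (𝓝 (d ^ ((5 : ℝ) / 8)))) →
    (∀ (D D' : DobrushinDomain), D.IsHullSubdomain D' →
      ∀ (φ : ConformalEquiv upperHalfPlaneSet D.carrier)
      (Φ : ConformalEquiv (upperHalfPlaneSet \ φ.pullbackHull D') upperHalfPlaneSet) (d : ℝ),
      D.IsChordalUniformizing φ → IsRestrictionMap (φ.pullbackHull D') Φ →
      HasRestrictionDeriv (φ.pullbackHull D') Φ d →
      ∀ ε : ℝ, 0 < ε → ∃ (D'' : DobrushinDomain)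
        (Φ'' : ConformalEquiv (upperHalfPlaneSet \ φ.pullbackHull D'') upperHalfPlaneSet) (d'' η : ℝ),
        D.IsHullSubdomain D'' ∧ D'.carrier ⊆ D''.carrier ∧ 0 < η ∧
        (∀ z ∈ D.carrier, Metric.infDist z D'.carrier ≤ η → z ∈ D''.carrier) ∧
        IsRestrictionMap (φ.pullbackHull D'') Φ'' ∧ HasRestrictionDeriv (φ.pullbackHull D'') Φ'' d'' ∧
        d'' ^ ((5 : ℝ) / 8) ≤ (1 + ε) * d ^ ((5 : ℝ) / 8)) →
    ∀ (D D' : DobrushinDomain) (ρ : ℝ) (a b : ℝ → HexVertex),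
    (0 < ρ ∧ (D.pt 1).im = (D.pt 0).im ∧ D.carrier ⊆ {z : ℂ | (D.pt 0).im < z.im} ∧
    D.carrier ∩ ball (D.pt 0) ρ = {z : ℂ | (D.pt 0).im < z.im} ∩ ball (D.pt 0) ρ ∧
    D.carrier ∩ ball (D.pt 1) ρ = {z : ℂ | (D.pt 1).im < z.im} ∩ ball (D.pt 1) ρ) →
    D.IsHullSubdomain D' →
    (IsEmbEndpointApprox hexGraph hexCenter D a b ∧ ∀ᶠ δ : ℝ in 𝓝[>] 0,
    (∃ u : HexVertex, hexGraph.Adj (a δ) u ∧ ((δ : ℂ) * hexCenter u).im ≤ (D.pt 0).im) ∧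
    (∃ u : HexVertex, hexGraph.Adj (b δ) u ∧ ((δ : ℂ) * hexCenter u).im ≤ (D.pt 1).im)) →
    ∃ (ρ' : ℝ) (Λ Λ' Λ'' : ℝ → Finset HexVertex) (m : ℝ → ℤ) (σa σb : ℝ → Sym2 HexVertex),
    0 < ρ' ∧ ρ' ≤ ρ ∧
    (∀ᶠ δ : ℝ in 𝓝[>] 0,
    Λ' δ ⊆ Λ δ ∧ hexDomainSimplyConnected (Λ δ) ∧ hexDomainSimplyConnected (Λ' δ) ∧
    (hexGraph.induce (↑(Λ δ) : Set HexVertex)).Preconnected ∧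
    (hexGraph.induce (↑(Λ' δ) : Set HexVertex)).Preconnected ∧
    σa δ ∈ hexDomainBoundary (Λ δ) ∧ σb δ ∈ hexDomainBoundary (Λ δ) ∧
    σa δ ∈ hexDomainBoundary (Λ' δ) ∧ σb δ ∈ hexDomainBoundary (Λ' δ) ∧
    Nonempty (HexMidEdgeSAW (Λ' δ) (σa δ) (σb δ)) ∧
    (∀ v ∈ Λ δ, (δ : ℂ) * hexCenter v ∈ D.carrier ∧ m δ ≤ v.1 1) ∧
    (∀ v ∈ Λ' δ, (δ : ℂ) * hexCenter v ∈ D'.carrier) ∧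
    (∀ v : HexVertex, (δ : ℂ) * hexCenter v ∈ ball (D.pt 0) ρ' ∪ ball (D.pt 1) ρ' →
    ((v ∈ Λ δ ↔ m δ ≤ v.1 1) ∧ (v ∈ Λ' δ ↔ m δ ≤ v.1 1)))) ∧
    (∀ K : Set ℂ, IsCompact K → K ⊆ D.carrier →
    ∀ᶠ δ : ℝ in 𝓝[>] 0, ∀ v : HexVertex, (δ : ℂ) * hexCenter v ∈ K → v ∈ Λ δ) ∧
    (∀ K : Set ℂ, IsCompact K → K ⊆ D'.carrier →
    ∀ᶠ δ : ℝ in 𝓝[>] 0, ∀ v : HexVertex, (δ : ℂ) * hexCenter v ∈ K → v ∈ Λ' δ) ∧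
    Tendsto (fun δ : ℝ => (δ : ℂ) * hexMidpoint (σa δ)) (𝓝[>] 0) (𝓝 (D.pt 0)) ∧
    Tendsto (fun δ : ℝ => (δ : ℂ) * hexMidpoint (σb δ)) (𝓝[>] 0) (𝓝 (D.pt 1)) ∧
    (∀ᶠ δ : ℝ in 𝓝[>] 0,
    Λ' δ ⊆ Λ'' δ ∧ Λ'' δ ⊆ Λ δ ∧
    (∀ v ∈ Λ δ, ∀ w ∈ Λ δ, hexGraph.Adj v w → (hexDomainGraph D.carrier δ).Adj v w) ∧
    (∀ v ∈ Λ' δ, ∀ w ∈ Λ' δ, hexGraph.Adj v w →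
    (embMeshGraph hexGraph hexCenter D'.carrier δ).Adj v w) ∧
    (∀ v ∈ Λ'' δ, ∀ w ∈ Λ δ, (δ : ℂ) * hexCenter w ∈ D'.carrier →
    (embMeshGraph hexGraph hexCenter D'.carrier δ).Adj v w → w ∈ Λ'' δ) ∧
    ((a δ).2 = 0 → m δ = (a δ).1 1 ∧ σa δ = s(a δ, ((a δ).1 - Pi.single 1 1, (1 : Fin 2)))) ∧
    ((a δ).2 = 1 → m δ = (a δ).1 1 + 1 ∧
    σa δ = s((((a δ).1 + Pi.single 1 1, (0 : Fin 2)) : HexVertex), a δ)) ∧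
    ((b δ).2 = 0 → σb δ = s(b δ, ((b δ).1 - Pi.single 1 1, (1 : Fin 2)))) ∧
    ((b δ).2 = 1 → σb δ = s((((b δ).1 + Pi.single 1 1, (0 : Fin 2)) : HexVertex), b δ))) ∧
    Tendsto (fun δ : ℝ => ((hexSAWLaw D.carrier δ (a δ) (b δ))
    {γ | ∀ v ∈ γ.walk.support, v ∈ Λ δ ∨ v = a δ ∨ v = b δ}).toReal) (𝓝[>] 0) (𝓝 1) ∧
    Tendsto (fun δ : ℝ =>
    (∑ γ : HexMidEdgeSAW (Λ'' δ) (σa δ) (σb δ), hexCriticalFugacity ^ γ.length) /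
    (∑ γ : HexMidEdgeSAW (Λ' δ) (σa δ) (σb δ), hexCriticalFugacity ^ γ.length))
    (𝓝[>] 0) (𝓝 1)
 := by
  intro H HA D D' ρ a b hfl hD' hend
  obtain ⟨ρ', Λ, Λ', Λ'', m, σa, σb, hρ'0, hρ'ρ, hADM, hK, hK', hσa, hσb, hL, hm, hflD'0, hflD'1,
    v₀, hv₀, hΛ, hΛ', hΛ''⟩ := discretisation_core D D' ρ a b hfl hD' hend
  have hD'D : D'.carrier ⊆ D.carrier := hD'.carrier_subset
  have hrows := stub_canonicalTransfer_admissibleRows D D'.carrier ρ' Λ Λ' m σa σb hADM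
  have hΛall : ∀ᶠ δ : ℝ in 𝓝[>] 0, hexDomainSimplyConnected (Λ δ) ∧
      (hexGraph.induce (↑(Λ δ) : Set HexVertex)).Preconnected ∧ _ :=
    (hADM.and hΛ).mono fun δ h => ⟨h.1.2.1, h.1.2.2.2.1, h.2⟩
  refine ⟨ρ', Λ, Λ', Λ'', m, σa, σb, hρ'0, hρ'ρ, hADM, hK, hK', hσa, hσb, hL,
    canonicalInsensitivity_of_hullApprox H HA D ρ ρ' a b Λ m v₀ hfl hend hρ'0 hm (hflD'0.trans hD'D)
      (hflD'1.trans hD'D) hv₀ hΛall (hrows.mono fun δ h v hv hvm => (h v hv hvm).1) hK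
      (hL.mono fun δ h => h.2.2.1), ?_⟩
  have hσa' : ∀ᶠ δ : ℝ in 𝓝[>] 0, σa δ = s(a δ, if (a δ).2 = 0 then
      (((a δ).1 - Pi.single 1 1, 1) : HexVertex) else ((a δ).1 + Pi.single 1 1, 0)) := by
    filter_upwards [hL] with δ h
    obtain ⟨-, -, -, -, -, h0, h1, -, -⟩ := h
    exact stub_canonicalTransfer_reduction (a δ) (σa δ) (fun hc => (h0 hc).2) (fun hc => (h1 hc).2)
  have hσb' : ∀ᶠ δ : ℝ in 𝓝[>] 0, σb δ = s(b δ, if (b δ).2 = 0 then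
      (((b δ).1 - Pi.single 1 1, 1) : HexVertex) else ((b δ).1 + Pi.single 1 1, 0)) := by
    filter_upwards [hL] with δ h
    obtain ⟨-, -, -, -, -, -, -, h0, h1⟩ := h
    exact stub_canonicalTransfer_reduction (b δ) (σb δ) h0 h1
  refine insensitivity_of_hullApprox H D D' ρ ρ' a b Λ Λ' Λ'' m σa σb v₀ hfl hD' hend (HA D D' hD')
    hρ'0 hm hflD'0 hflD'1 hv₀ hΛall ?_ hΛ'' hrows hK hK' hσa' hσb'
  filter_upwards [hADM, hΛ'] with δ h1 h2
  exact ⟨h1.2.2.1, h1.2.2.2.2.1, h2⟩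

/-- **`stub_canonicalTransfer` FROM (HA) ALONE**: the registered statement of the stub
`stub_canonicalTransfer` (admissible restriction limit `→` floor restriction limit for the canonical
law), verbatim, follows from the single continuum hypothesis (HA) hull approximation from outside
(`canonicalTransfer_ofDiscretisation` with `discretisation_of_hullApprox`).
[cite: LawlerSchrammWerner2004SAW, §3.4 ("SAW satisfies restriction")] -/
theorem canonicalTransfer_of_hullApprox :
    (∀ (D D' : DobrushinDomain), D.IsHullSubdomain D' →
      ∀ (φ : ConformalEquiv upperHalfPlaneSet D.carrier)
      (Φ : ConformalEquiv (upperHalfPlaneSet \ φ.pullbackHull D') upperHalfPlaneSet) (d : ℝ),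
      D.IsChordalUniformizing φ → IsRestrictionMap (φ.pullbackHull D') Φ →
      HasRestrictionDeriv (φ.pullbackHull D') Φ d →
      ∀ ε : ℝ, 0 < ε → ∃ (D'' : DobrushinDomain)
        (Φ'' : ConformalEquiv (upperHalfPlaneSet \ φ.pullbackHull D'') upperHalfPlaneSet) (d'' η : ℝ),
        D.IsHullSubdomain D'' ∧ D'.carrier ⊆ D''.carrier ∧ 0 < η ∧
        (∀ z ∈ D.carrier, Metric.infDist z D'.carrier ≤ η → z ∈ D''.carrier) ∧
        IsRestrictionMap (φ.pullbackHull D'') Φ'' ∧ HasRestrictionDeriv (φ.pullbackHull D'') Φ'' d'' ∧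
        d'' ^ ((5 : ℝ) / 8) ≤ (1 + ε) * d ^ ((5 : ℝ) / 8)) →
    (
    ∀ (D D' : DobrushinDomain) (ρ : ℝ) (φ : ConformalEquiv upperHalfPlaneSet D.carrier)
    (Φ : ConformalEquiv (upperHalfPlaneSet \ φ.pullbackHull D') upperHalfPlaneSet) (d : ℝ)
    (Λ Λ' : ℝ → Finset HexVertex) (m : ℝ → ℤ) (a b : ℝ → Sym2 HexVertex),
    (0 < ρ ∧ (D.pt 1).im = (D.pt 0).im ∧ D.carrier ⊆ {z : ℂ | (D.pt 0).im < z.im} ∧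
    D.carrier ∩ ball (D.pt 0) ρ = {z : ℂ | (D.pt 0).im < z.im} ∩ ball (D.pt 0) ρ ∧
    D.carrier ∩ ball (D.pt 1) ρ = {z : ℂ | (D.pt 1).im < z.im} ∩ ball (D.pt 1) ρ) → D.IsHullSubdomain D' → D.IsChordalUniformizing φ →
    IsRestrictionMap (φ.pullbackHull D') Φ → HasRestrictionDeriv (φ.pullbackHull D') Φ d →
    (∀ᶠ δ : ℝ in 𝓝[>] 0,
    Λ' δ ⊆ Λ δ ∧ hexDomainSimplyConnected (Λ δ) ∧ hexDomainSimplyConnected (Λ' δ) ∧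
    (hexGraph.induce (↑(Λ δ) : Set HexVertex)).Preconnected ∧
    (hexGraph.induce (↑(Λ' δ) : Set HexVertex)).Preconnected ∧
    a δ ∈ hexDomainBoundary (Λ δ) ∧ b δ ∈ hexDomainBoundary (Λ δ) ∧
    a δ ∈ hexDomainBoundary (Λ' δ) ∧ b δ ∈ hexDomainBoundary (Λ' δ) ∧
    Nonempty (HexMidEdgeSAW (Λ' δ) (a δ) (b δ)) ∧
    (∀ v ∈ Λ δ, (δ : ℂ) * hexCenter v ∈ D.carrier ∧ m δ ≤ v.1 1) ∧
    (∀ v ∈ Λ' δ, (δ : ℂ) * hexCenter v ∈ D'.carrier) ∧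
    (∀ v : HexVertex, (δ : ℂ) * hexCenter v ∈ ball (D.pt 0) ρ ∪ ball (D.pt 1) ρ →
    ((v ∈ Λ δ ↔ m δ ≤ v.1 1) ∧ (v ∈ Λ' δ ↔ m δ ≤ v.1 1)))) →
    (∀ K : Set ℂ, IsCompact K → K ⊆ D.carrier →
    ∀ᶠ δ : ℝ in 𝓝[>] 0, ∀ v : HexVertex, (δ : ℂ) * hexCenter v ∈ K → v ∈ Λ δ) →
    (∀ K : Set ℂ, IsCompact K → K ⊆ D'.carrier →
    ∀ᶠ δ : ℝ in 𝓝[>] 0, ∀ v : HexVertex, (δ : ℂ) * hexCenter v ∈ K → v ∈ Λ' δ) →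
    Tendsto (fun δ : ℝ => (δ : ℂ) * hexMidpoint (a δ)) (𝓝[>] 0) (𝓝 (D.pt 0)) →
    Tendsto (fun δ : ℝ => (δ : ℂ) * hexMidpoint (b δ)) (𝓝[>] 0) (𝓝 (D.pt 1)) →
    Tendsto (fun δ : ℝ => (∑ γ : HexMidEdgeSAW (Λ' δ) (a δ) (b δ), hexCriticalFugacity ^ γ.length) /
    (∑ γ : HexMidEdgeSAW (Λ δ) (a δ) (b δ), hexCriticalFugacity ^ γ.length)) (𝓝[>] 0)
    (𝓝 (d ^ ((5 : ℝ) / 8)))) →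
  ∀ (D D' : DobrushinDomain) (ρ : ℝ) (φ : ConformalEquiv upperHalfPlaneSet D.carrier)
  (Φ : ConformalEquiv (upperHalfPlaneSet \ φ.pullbackHull D') upperHalfPlaneSet) (d : ℝ)
  (a b : ℝ → HexVertex),
  (0 < ρ ∧ (D.pt 1).im = (D.pt 0).im ∧ D.carrier ⊆ {z : ℂ | (D.pt 0).im < z.im} ∧
  D.carrier ∩ ball (D.pt 0) ρ = {z : ℂ | (D.pt 0).im < z.im} ∩ ball (D.pt 0) ρ ∧
  D.carrier ∩ ball (D.pt 1) ρ = {z : ℂ | (D.pt 1).im < z.im} ∩ ball (D.pt 1) ρ) → D.IsHullSubdomain D' → D.IsChordalUniformizing φ →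
  IsRestrictionMap (φ.pullbackHull D') Φ → HasRestrictionDeriv (φ.pullbackHull D') Φ d →
  (IsEmbEndpointApprox hexGraph hexCenter D a b ∧ ∀ᶠ δ : ℝ in 𝓝[>] 0,
  (∃ u : HexVertex, hexGraph.Adj (a δ) u ∧ ((δ : ℂ) * hexCenter u).im ≤ (D.pt 0).im) ∧
  (∃ u : HexVertex, hexGraph.Adj (b δ) u ∧ ((δ : ℂ) * hexCenter u).im ≤ (D.pt 1).im)) →
  Tendsto (fun δ : ℝ => ((hexSAWLaw D.carrier δ (a δ) (b δ))
  {γ | (∀ v ∈ γ.walk.support, v ∈ embMeshVertices hexCenter D'.carrier δ) ∧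
  ∀ e ∈ γ.walk.darts,
  (embMeshGraph hexGraph hexCenter D'.carrier δ).Adj e.fst e.snd}).toReal)
  (𝓝[>] 0) (𝓝 (d ^ ((5 : ℝ) / 8))) :=
  fun HA hARL => canonicalTransfer_ofDiscretisation (fun H => discretisation_of_hullApprox H HA) hARL

end Summit.CriticalPhenomena.SAWScalingLimit.Theorems.ObservableToSLE.FloorRatio

end
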